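import Summits.HubbardSuperconductivity.HubbardSuperconductivity.Theorems.TwSeededEnsembleEquivalence.Negative.SeedLeverage
import Summits.HubbardSuperconductivity.HubbardSuperconductivity.Theorems.TwSeededEnsembleEquivalence.Negative.ObstructionTemplates
import Literature.MathematicalPhysics.QuantumLattice.SectorSpectrum
import Literature.MathematicalPhysics.QuantumLattice.FinDimSpectrumSectorGibbsLimit
import Literature.MathematicalPhysics.QuantumLattice.HubbardGrandCanonicalDensity
import Literature.MathematicalPhysics.QuantumLattice.XYOrderGDProofs

/-!
# Seed transfer (Template E) for crux `TwSeededEnsembleEquivalence` (stmt-HubbardSuperconductivity-1698)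

Negative-side support lemmas (refuter, cdisprove gen 3), all sorry-free and definition-free.
The seed `−(g/L²) ΔᴴΔ` is `−g ×` (positive semidefinite), so every energy of the seeded model is
non-increasing in `g` and moves by at most `32 (g − g₀) L²` between seeds `g₀ ≤ g`
(`‖Δ_d‖² ≤ 32 L⁴`, `Negative/SeedLeverage`):

* `re_rayleigh_seededCan_anti`, `minEnergyOn_seededCan_anti` — Rayleigh quotients and sector
  energies of `hubbardTorus 2 L 1 U − (g/L²)ΔᴴΔ` are non-increasing in `g`;
* `groundEnergy_seededGC_anti`, `groundEnergy_seededGC_le_add` — the grand-canonical ground energy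
  `E₀(hubbardTorusWith 2 L 1 U μ − (g/L²)ΔᴴΔ)` is non-increasing in `g` and drops by at most
  `32 (g − g₀) L²`;
* `hullGap_seed_transfer`, `hullGap_le_hullGap_add` — TEMPLATE E: the T = 0 hull gap of the crux's
  normal form (`Negative/HullTouchNormalForm`) at seed `g` exceeds the hull gap at any smaller seed
  `g₀` (same slope `μ`, same sector) by at most the grand-canonical ground-energy SEED RESPONSE
  `E₀(g₀) − E₀(g) ∈ [0, 32 (g − g₀) L²]`. Reading for disprovers: relative to the pure model
  (`g₀ → 0⁺`, where short-range ensemble equivalence excludes a macroscopic gap) a kill at seed `g`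
  has margin at most the T = 0 grand-canonical condensation energy of the seed, `≤ 32 g` per site.

See `Cruxes/TwSeededEnsembleEquivalence/Disproof.lean` (gen 3) for the analysis these serve.
-/

namespace Summit.HubbardSuperconductivity.HubbardSuperconductivity.Theorems.TwSeededEnsembleEquivalence.Negative

open Matrix Literature.MathematicalPhysics.QuantumLattice
open Summit.HubbardSuperconductivity.HubbardSuperconductivity.Theses.ThermalWedge
open scoped ComplexOrder

noncomputable section

/-- **Rayleigh quotients of the seeded canonical Hamiltonian are non-increasing in the seed.** -/
theorem re_rayleigh_seededCan_anti (L : ℕ) [NeZero L] (U : ℝ) {g₀ g : ℝ} (hg : g₀ ≤ g)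
    (ψ : Fock (Orb (FermionTorus 2 L))) :
    (star ψ ⬝ᵥ (hubbardTorus 2 L 1 U - ((g / (L : ℝ) ^ 2 : ℝ) : ℂ) •
        ((pairField dWaveFormFactor L)ᴴ * pairField dWaveFormFactor L)) *ᵥ ψ).re ≤
      (star ψ ⬝ᵥ (hubbardTorus 2 L 1 U - ((g₀ / (L : ℝ) ^ 2 : ℝ) : ℂ) •
        ((pairField dWaveFormFactor L)ᴴ * pairField dWaveFormFactor L)) *ᵥ ψ).re := by
  rw [re_rayleigh_Hcan_eq, re_rayleigh_Hcan_eq]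
  have hP := re_rayleigh_seed_nonneg L ψ
  have hL : (0 : ℝ) < (L : ℝ) ^ 2 := cast_sq_pos_of_neZero L
  have : g₀ / (L : ℝ) ^ 2 ≤ g / (L : ℝ) ^ 2 := div_le_div_of_nonneg_right hg hL.le
  nlinarith

/-- **Sector energies of the seeded canonical Hamiltonian are non-increasing in the seed**
(`K ≠ ⊥` any subspace, e.g. `szSector N M`). -/
theorem minEnergyOn_seededCan_anti (L : ℕ) [NeZero L] (U : ℝ) {g₀ g : ℝ} (hg : g₀ ≤ g)
    (K : Submodule ℂ (Fock (Orb (FermionTorus 2 L)))) (hK : K ≠ ⊥) :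
    (hubbardTorus 2 L 1 U - ((g / (L : ℝ) ^ 2 : ℝ) : ℂ) •
        ((pairField dWaveFormFactor L)ᴴ * pairField dWaveFormFactor L)).minEnergyOn K ≤
      (hubbardTorus 2 L 1 U - ((g₀ / (L : ℝ) ^ 2 : ℝ) : ℂ) •
        ((pairField dWaveFormFactor L)ᴴ * pairField dWaveFormFactor L)).minEnergyOn K := by
  obtain ⟨v, hvK, hv0⟩ := (Submodule.ne_bot_iff K).1 hK
  obtain ⟨c, -, hc1⟩ := exists_smul_unit hv0
  have hH : (hubbardTorus 2 L 1 U - ((g / (L : ℝ) ^ 2 : ℝ) : ℂ) •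
      ((pairField dWaveFormFactor L)ᴴ * pairField dWaveFormFactor L)).IsHermitian := by
    have h : (hubbardTorus 2 L 1 U).IsHermitian := by
      rw [← hubbardTorusWith_zero]; exact isHermitian_hubbardTorusWith L 1 U 0
    exact h.sub (isHermitian_smul_seed L _)
  refine le_csInf ⟨_, c • v, K.smul_mem c hvK, hc1, rfl⟩ ?_
  rintro E ⟨φ, hφK, hφ1, rfl⟩
  exact (minEnergyOn_le_rayleigh_of_mem hH K hφK hφ1).trans (re_rayleigh_seededCan_anti L U hg φ)

/-- Difference of two grand-canonical seeded Hamiltonians: `H(g₀) − H(g) = ((g − g₀)/L²) ΔᴴΔ`. -/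
theorem seededGC_sub_seededGC (L : ℕ) [NeZero L] (U μ g₀ g : ℝ) :
    (hubbardTorusWith 2 L 1 U μ - ((g₀ / (L : ℝ) ^ 2 : ℝ) : ℂ) •
        ((pairField dWaveFormFactor L)ᴴ * pairField dWaveFormFactor L)) -
      (hubbardTorusWith 2 L 1 U μ - ((g / (L : ℝ) ^ 2 : ℝ) : ℂ) •
        ((pairField dWaveFormFactor L)ᴴ * pairField dWaveFormFactor L)) =
      (((g - g₀) / (L : ℝ) ^ 2 : ℝ) : ℂ) •
        ((pairField dWaveFormFactor L)ᴴ * pairField dWaveFormFactor L) := by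
  rw [sub_sub_sub_cancel_left, ← sub_smul]
  congr 1
  push_cast
  ring

/-- **The grand-canonical seeded ground energy is non-increasing in the seed** (Loewner order:
`H(g) ≤ H(g₀)` for `g₀ ≤ g`). -/
theorem groundEnergy_seededGC_anti (L : ℕ) [NeZero L] (U μ : ℝ) {g₀ g : ℝ} (hg : g₀ ≤ g) :
    (hubbardTorusWith 2 L 1 U μ - ((g / (L : ℝ) ^ 2 : ℝ) : ℂ) •
        ((pairField dWaveFormFactor L)ᴴ * pairField dWaveFormFactor L)).groundEnergy ≤
      (hubbardTorusWith 2 L 1 U μ - ((g₀ / (L : ℝ) ^ 2 : ℝ) : ℂ) •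
        ((pairField dWaveFormFactor L)ᴴ * pairField dWaveFormFactor L)).groundEnergy := by
  refine groundEnergy_mono_of_posSemidef_sub (isHermitian_seededGC L U μ g)
    (isHermitian_seededGC L U μ g₀) ?_
  rw [seededGC_sub_seededGC]
  refine (pairField_conjTranspose_mul_self_posSemidef dWaveFormFactor L).smul ?_
  have hL : (0 : ℝ) < (L : ℝ) ^ 2 := cast_sq_pos_of_neZero L
  exact Complex.zero_le_real.2 (div_nonneg (sub_nonneg.2 hg) hL.le)

/-- **Seed response of the grand-canonical ground energy is at most `32 (g − g₀) L²`**
(the ground state at seed `g` is a trial state at seed `g₀`; `Re⟨ψ, ΔᴴΔ ψ⟩ ≤ ‖Δ‖² ≤ 32 L⁴`). -/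
theorem groundEnergy_seededGC_le_add (L : ℕ) [NeZero L] (U μ : ℝ) {g₀ g : ℝ} (hg : g₀ ≤ g) :
    (hubbardTorusWith 2 L 1 U μ - ((g₀ / (L : ℝ) ^ 2 : ℝ) : ℂ) •
        ((pairField dWaveFormFactor L)ᴴ * pairField dWaveFormFactor L)).groundEnergy ≤
      (hubbardTorusWith 2 L 1 U μ - ((g / (L : ℝ) ^ 2 : ℝ) : ℂ) •
        ((pairField dWaveFormFactor L)ᴴ * pairField dWaveFormFactor L)).groundEnergy +
        32 * (g - g₀) * (L : ℝ) ^ 2 := by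
  obtain ⟨ψ, hψ1, hray⟩ := Matrix.exists_groundState_unit (isHermitian_seededGC L U μ g)
  have htrial := groundEnergy_le_rayleigh_holds (isHermitian_seededGC L U μ g₀) ψ hψ1
  have hdecomp : hubbardTorusWith 2 L 1 U μ - ((g₀ / (L : ℝ) ^ 2 : ℝ) : ℂ) •
      ((pairField dWaveFormFactor L)ᴴ * pairField dWaveFormFactor L) =
      (hubbardTorusWith 2 L 1 U μ - ((g / (L : ℝ) ^ 2 : ℝ) : ℂ) •
        ((pairField dWaveFormFactor L)ᴴ * pairField dWaveFormFactor L)) +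
        (((g - g₀) / (L : ℝ) ^ 2 : ℝ) : ℂ) •
          ((pairField dWaveFormFactor L)ᴴ * pairField dWaveFormFactor L) := by
    rw [← seededGC_sub_seededGC L U μ g₀ g, add_sub_cancel]
  have hsplit : (star ψ ⬝ᵥ (hubbardTorusWith 2 L 1 U μ - ((g₀ / (L : ℝ) ^ 2 : ℝ) : ℂ) •
      ((pairField dWaveFormFactor L)ᴴ * pairField dWaveFormFactor L)) *ᵥ ψ).re =
      (hubbardTorusWith 2 L 1 U μ - ((g / (L : ℝ) ^ 2 : ℝ) : ℂ) •
        ((pairField dWaveFormFactor L)ᴴ * pairField dWaveFormFactor L)).groundEnergy +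
        (g - g₀) / (L : ℝ) ^ 2 *
          (star ψ ⬝ᵥ ((pairField dWaveFormFactor L)ᴴ * pairField dWaveFormFactor L) *ᵥ ψ).re := by
    rw [hdecomp, add_mulVec, dotProduct_add, Complex.add_re, hray, smul_mulVec, dotProduct_smul,
      smul_eq_mul, Complex.re_ofReal_mul]
  rw [hsplit] at htrial
  have hL : (0 : ℝ) < (L : ℝ) ^ 2 := cast_sq_pos_of_neZero L
  have hP : (star ψ ⬝ᵥ ((pairField dWaveFormFactor L)ᴴ * pairField dWaveFormFactor L) *ᵥ ψ).re ≤
      32 * ((L : ℝ) ^ 2) ^ 2 := (re_rayleigh_seed_le L hψ1).trans (norm_pairField_sq_le L)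
  have hcoef : 0 ≤ (g - g₀) / (L : ℝ) ^ 2 := div_nonneg (sub_nonneg.2 hg) hL.le
  have h2 : (g - g₀) / (L : ℝ) ^ 2 *
      (star ψ ⬝ᵥ ((pairField dWaveFormFactor L)ᴴ * pairField dWaveFormFactor L) *ᵥ ψ).re ≤
      (g - g₀) / (L : ℝ) ^ 2 * (32 * ((L : ℝ) ^ 2) ^ 2) := mul_le_mul_of_nonneg_left hP hcoef
  have h3 : (g - g₀) / (L : ℝ) ^ 2 * (32 * ((L : ℝ) ^ 2) ^ 2) = 32 * (g - g₀) * (L : ℝ) ^ 2 := by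
    field_simp
  linarith

/-- **Template E (seed transfer of the T = 0 hull gap).** For seeds `g₀ ≤ g`, every slope `μ`,
every `ν` (read `ν = μ N`) and every sector `K ≠ ⊥`:
`[E_K(g) − ν − E₀(g)] ≤ [E_K(g₀) − ν − E₀(g₀)] + [E₀(g₀) − E₀(g)]` — the hull gap at seed `g`
exceeds the hull gap at the smaller seed by at most the grand-canonical ground-energy seed response
(which is `≥ 0` by `groundEnergy_seededGC_anti`). -/
theorem hullGap_seed_transfer (L : ℕ) [NeZero L] (U μ ν : ℝ) {g₀ g : ℝ} (hg : g₀ ≤ g)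
    (K : Submodule ℂ (Fock (Orb (FermionTorus 2 L)))) (hK : K ≠ ⊥) :
    (hubbardTorus 2 L 1 U - ((g / (L : ℝ) ^ 2 : ℝ) : ℂ) •
          ((pairField dWaveFormFactor L)ᴴ * pairField dWaveFormFactor L)).minEnergyOn K - ν -
        (hubbardTorusWith 2 L 1 U μ - ((g / (L : ℝ) ^ 2 : ℝ) : ℂ) •
          ((pairField dWaveFormFactor L)ᴴ * pairField dWaveFormFactor L)).groundEnergy ≤
      ((hubbardTorus 2 L 1 U - ((g₀ / (L : ℝ) ^ 2 : ℝ) : ℂ) •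
          ((pairField dWaveFormFactor L)ᴴ * pairField dWaveFormFactor L)).minEnergyOn K - ν -
        (hubbardTorusWith 2 L 1 U μ - ((g₀ / (L : ℝ) ^ 2 : ℝ) : ℂ) •
          ((pairField dWaveFormFactor L)ᴴ * pairField dWaveFormFactor L)).groundEnergy) +
      ((hubbardTorusWith 2 L 1 U μ - ((g₀ / (L : ℝ) ^ 2 : ℝ) : ℂ) •
          ((pairField dWaveFormFactor L)ᴴ * pairField dWaveFormFactor L)).groundEnergy -
        (hubbardTorusWith 2 L 1 U μ - ((g / (L : ℝ) ^ 2 : ℝ) : ℂ) •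
          ((pairField dWaveFormFactor L)ᴴ * pairField dWaveFormFactor L)).groundEnergy) := by
  have h := minEnergyOn_seededCan_anti L U hg K hK
  linarith

/-- **Template E, numerical form.** The hull gap at seed `g` is at most the hull gap at any smaller
seed `g₀` plus `32 (g − g₀) L²`; in particular (g₀ → 0⁺) at most the PURE model's hull gap plus
`32 g L²`: a kill margin `κ` at seed `g` is `< 32 g` once the pure short-range model is known to
have no macroscopic hull gap. -/
theorem hullGap_le_hullGap_add (L : ℕ) [NeZero L] (U μ ν : ℝ) {g₀ g : ℝ} (hg : g₀ ≤ g)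
    (K : Submodule ℂ (Fock (Orb (FermionTorus 2 L)))) (hK : K ≠ ⊥) :
    (hubbardTorus 2 L 1 U - ((g / (L : ℝ) ^ 2 : ℝ) : ℂ) •
          ((pairField dWaveFormFactor L)ᴴ * pairField dWaveFormFactor L)).minEnergyOn K - ν -
        (hubbardTorusWith 2 L 1 U μ - ((g / (L : ℝ) ^ 2 : ℝ) : ℂ) •
          ((pairField dWaveFormFactor L)ᴴ * pairField dWaveFormFactor L)).groundEnergy ≤
      ((hubbardTorus 2 L 1 U - ((g₀ / (L : ℝ) ^ 2 : ℝ) : ℂ) •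
          ((pairField dWaveFormFactor L)ᴴ * pairField dWaveFormFactor L)).minEnergyOn K - ν -
        (hubbardTorusWith 2 L 1 U μ - ((g₀ / (L : ℝ) ^ 2 : ℝ) : ℂ) •
          ((pairField dWaveFormFactor L)ᴴ * pairField dWaveFormFactor L)).groundEnergy) +
      32 * (g - g₀) * (L : ℝ) ^ 2 := by
  have h1 := hullGap_seed_transfer L U μ ν hg K hK
  have h2 := groundEnergy_seededGC_le_add L U μ hg
  linarith

end

end Summit.HubbardSuperconductivity.HubbardSuperconductivity.Theorems.TwSeededEnsembleEquivalence.Negative
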